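import Summits.Ventures.CertifiedManyBodySolver.Downfold.BoxesLa214V115M2cPhaseSeparationThermalHotAnchor
import Summits.Ventures.CertifiedManyBodySolver.Observables.PhaseSeparationExclusionBoxLayered
import HarnessLib

/-!
# Ventures/CertifiedManyBodySolver — Downfold/BoxesLa214V115M2cPhaseSeparationLayered.lean: THE INTERLAYER (c-axis) AXIS of the LSCO `x = 1/8`
# «competing orders» cell — `(≤ 1/5 | ≥ 1)` coexistence EXCLUDED on `t′/t ∈ [−3/10, −1/5] × U/t ∈ [79/10, 81/10]` FOR THE 3D LAYERED CRYSTAL: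
# at `T = 0` for every stacking with `(4/π)Σ_b|t_{z,b}| ≤ t/30`; at `T > 0` for every `β ≥ 30` and every stacking with `(4/π)Σ_b|t_{z,b}| ≤ t/100`

HONEST FRAMING: the INTERLAYER reading of `Downfold/BoxesLa214V115M2cPhaseSeparation{,ThermalHotAnchor}.lean` on the La₂₋ₓSrₓCuO₄ `x = 1/8`
one-band box (`t′/t ∈ [−3/10, −1/5]`, filling `7/8`): EXCLUSION of macroscopic coexistence of the half-filled (or denser) phase with a DILUTE
phase (density `≤ 1/5`) among ground states (`T = 0`) and canonical equilibrium states (`T > 0`) of the 3D LAYERED `t–t′` Hubbard crystal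
`layeredHubbardTTPrime 1 s U w tz` (ANY stacking vectors `w_b` with `(w_b)₀ ≠ 0` in a range box `R' ≥ 1`, hoppings `tz_b`, entering only through
the kinematic cost `(4/π)Σ_b|tz_b| ≤ k`) — CONTROL class; conditional BY NAME on the parents' 2D claim nodes (VARBOX plane
`cert_obx32x4tpm1o4D1200_openbox_32x4_N112_planes`; K2DIAG-A bootstraps `cert_laBoxE_K2diag_GU29o5n1tpm3o10_j295889_up`,
`cert_laBoxE_K2diag_GU8n1tpm3o10_j299783_up`; registry #21 · #487 · #427 · #488 · #472 · #428; dilute Fermi-sea rows) AND (for `T > 0`) on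
hubbard-thermal-p2's 2D corner Markov anchors `cert_feC1tt_3x2_tpm5o16_U15o2_b3o4_j290715` / `…tpm3o16…_j290716` READ AT `n = 1`; the cost is
the CRUDE linear kinematic bound (true interlayer energies are `O(t_z²/t)`): THE BOX'S OWN INTERLAYER ROW (`t⊥/t ∈ [0.028, 0.069]` FS-measure;
bct stacking, four `t_z(a/2,a/2,c/2) ≈ 8 meV` bonds ⇒ `Σ|t_z| ≈ 0.07 t`, cost `≈ 0.09 t` > every margin here) IS NOT COVERED — this file certifies
the reach `(4/π)Σ|t_z| ≤ t/30` (`T = 0`) / `t/100` (`T > 0`) and names the lever (a second-order interlayer bound, or a larger 2D margin);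
nothing about stripes, c-axis transport, 3D ordering, superconductivity or `T_c`; nothing about La₁.₈₇₅Sr₀.₁₂₅CuO₄; no number of record. Zero compute.

Cell `pub/hubbard-downfold` (MO-S1 ↔ S2 seam; D-0096 (iii) «model order → real material: interlayer coupling × competing orders»), seat
`hubbard-downfold-unc-2` (`prover-hubbard-downfold-unc-2-g21-0`). Instrument: `Observables/PhaseSeparationExclusionBoxLayered.lean` (column forms
for the layered crystal; laws of `Literature/…/HubbardTTPrimePhaseCoexistenceExclusionLayered.lean`): the 2D inputs are unchanged, every margin
loses the constant `k`. THE CELLS (exact threshold checks at the `s`-ends of each column, `norm_num; nlinarith`; scan `gen-g21/lsco_field_cells.py`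
with the cost `k` in place of the field cost):
* §1 `T = 0`: `lsco78_not_layeredGroundState_mix_le_1o5_ge_one_of_cost_le_1o30` — every stacking with `(4/π)Σ|tz| ≤ 1/30` (smallest 2D column
  margin `0.0348`, `0.0015` to spare);
* §2 `T > 0`: `lsco78_not_layeredEquilibrium_mix_le_1o5_ge_one_beta30_of_cost_le_1o100` — EVERY `β ≥ 30` and EVERY stacking with
  `(4/π)Σ|tz| ≤ 1/100` (`β₀(k) = 29.06`; `k = 0`: `β ≥ 21`; scan: `β ≥ 25` @ `k ≤ 1/200`, `β ≥ 33` @ `1/80`, `β ≥ 38` @ `1/64`).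
READING (D-0096 (iii), CONTROL): «the LSCO x = 1/8 competing-orders cell word is a word of the 3D layered crystal for every stacking with
kinematic interlayer cost ≤ t/100 (≈ 3.4–4 meV on t ∈ [0.34, 0.40] eV [float]) up to T ≈ t/30, and at T = 0 up to cost t/30».
WHAT THIS IS NOT: a certificate; a statement about the material's actual bct interlayer coupling (not covered, see above), about other `U`,
other `β`, or about La₁.₈₇₅Sr₀.₁₂₅CuO₄; a stripe / superconductivity / `T_c` sentence; the anchors are PRODUCER-CERTIFIED claim nodes.
References: R. B. Israel, *Convexity in the Theory of Lattice Gases* (1979) Thm I.2.4 [Israel1979]; O. Bratteli, A. Kishimoto, D. W. Robinson,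
CMP 64 (1978) 41 [BratteliKishimotoRobinson1978]; E. Pavarini et al., PRL 87 (2001) 047003 [PavariniEtAl2001]; D. Poulin, M. B. Hastings, PRL 106
(2011) 080403 [PoulinHastings2011]; V. J. Emery, S. A. Kivelson, H. Q. Lin, PRL 64 (1990) 475 [EmeryKivelsonLin1990].
-/

noncomputable section

namespace Summit.Ventures.CertifiedManyBodySolver.Downfold

open Summit.Ventures.CertifiedManyBodySolver.Observables
open Summit.Ventures.CertifiedManyBodySolver.Certificates
open Literature.MathematicalPhysics.QuantumLattice Literature.MathematicalPhysics.QuantumLattice.ThermodynamicLimit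
open Literature.MathematicalPhysics.QuantumLattice.InfVolFermionState Set Filter
open Literature.Probability.LatticeModels HubbardWave0
open scoped BigOperators

/-! ## §1 `T = 0`: `(≤ 1/5 | ≥ 1)` coexistence EXCLUDED among ground states of the LAYERED crystal on `t′ ∈ [−3/10, −1/5] × U ∈ [79/10, 81/10]`, every stacking with `(4/π)Σ|tz| ≤ 1/30` -/

/-- **Left `t′`-half, columns `[79/10, 8]`, `n₁ = 1/5`, `T = 0`, layered, cost `≤ 1/30`.** [cite: Israel1979, Thm. I.2.4] [cite: BratteliKishimotoRobinson1978, Thm. 2 (condition 2)] [cite: EmeryKivelsonLin1990, pp. 475–476] -/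
theorem lsco78_psL_1o5_k1o30_left_columns (hVB : cert_obx32x4tpm1o4D1200_openbox_32x4_N112_planes)
    (hK29 : cert_laBoxE_K2diag_GU29o5n1tpm3o10_j295889_up) (hK8 : cert_laBoxE_K2diag_GU8n1tpm3o10_j299783_up)
    (h21 : cert_r21_luc_tl_upper_n1_U6) (h487 : cert_r487_hubSQ_hanK7R6_U10_r5_e4_so4blk)
    (h427 : cert_r427_hubSQ_hanK7_U5_r5_e4_so4blk) (h488 : cert_r488_hubSQ_hanK7R6_U6_r5_e4_so4blk)
    (h472 : cert_r472_pb2_tl_upper_n1_U8) (h428 : cert_r428_hubSQ_hanK7R6_U8_r5_e4_so4blk)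
    {s : ℝ} (hs : s ∈ Icc (-3 / 10 : ℝ) (-1 / 4)) {U : ℝ} (hU : U ∈ Icc (79 / 10 : ℝ) (8))
    {κ : Type*} [Fintype κ] {w : κ → Site 3} (hw : ∀ b, w b 0 ≠ 0) {tz : κ → ℝ} {R' : ℝ} (hR' : 1 ≤ R')
    (hwR' : ∀ b, w b ∈ thicken ({0} : Finset (Site 3)) R') (hk : 4 / Real.pi * ∑ b, |tz b| ≤ 1 / 30)
    {ω₁ ω₂ : InfVolFermionState 3} (h₁ : ω₁.IsTranslationInvariant) (h₂ : ω₂.IsTranslationInvariant)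
    (hρ₁ : 0 < ω₁.density) (hρ₁' : ω₁.density ≤ 1 / 5) (hρ₂ : 1 ≤ ω₂.density) (hρ₂' : ω₂.density < 2)
    {lam : ℝ} (hl0 : 0 < lam) (hl1 : lam < 1) :
    (layeredHubbardTTPrime 1 s U w tz).tiGroundEnergyDensityAt R' (mix lam hl0.le hl1.le ω₁ ω₂).density <
      (mix lam hl0.le hl1.le ω₁ ω₂).meanEnergy (layeredHubbardTTPrime 1 s U w tz) R' := by
  refine psL_not_layeredGroundState_mix_on_cell_of_columns 1 hw tz hR' hwR' (s₁ := -3 / 10) (s₂ := -1 / 4) (U₁ := 79 / 10) (U₂ := 8)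
    (n₁ := 1 / 5) (n₂ := 1) (a := 5 / 32) (b := 27 / 32) (k := 1 / 30)
    (by norm_num) (by norm_num) (by norm_num) (by norm_num) (by norm_num) (by norm_num) (by norm_num) (by norm_num)
    (lsco78_capPlane_on_cell_of hVB (by norm_num) (by norm_num) (by norm_num))
    (fun s hs => lsco_n1_lawAt_of hK29 hK8 h21 h487 h427 h488 h472 h428 (U₀ := 79 / 10) (by norm_num) s
      ⟨hs.1.trans' (by norm_num), hs.2.trans (by norm_num)⟩)
    (fun s hs => lsco_n1_law8_of hK8 h472 h428 s ⟨hs.1.trans' (by norm_num), hs.2.trans (by norm_num)⟩)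
    (fun s hs U hU => lsco_dilute14_floor_left (n₁ := 1 / 5) (by norm_num) (by norm_num) s hs U (by linarith [hU.1]))
    hk ?_ ?_ hs hU h₁ h₂ hρ₁ hρ₁' hρ₂ hρ₂' hl0 hl1
  · intro s hs; obtain ⟨h1, h2⟩ := hs; push_cast; norm_num; nlinarith [h1, h2]
  · intro s hs; obtain ⟨h1, h2⟩ := hs; push_cast; norm_num; nlinarith [h1, h2]

/-- **Left `t′`-half, `U ∈ [8, 81/10]`, `n₁ = 1/5`, `T = 0`, layered, cost `≤ 1/30`.** [cite: Israel1979, Thm. I.2.4] [cite: BratteliKishimotoRobinson1978, Thm. 2 (condition 2)] -/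
theorem lsco78_psL_1o5_k1o30_left_above (hVB : cert_obx32x4tpm1o4D1200_openbox_32x4_N112_planes)
    (hK8 : cert_laBoxE_K2diag_GU8n1tpm3o10_j299783_up)
    (h472 : cert_r472_pb2_tl_upper_n1_U8) (h428 : cert_r428_hubSQ_hanK7R6_U8_r5_e4_so4blk)
    {s : ℝ} (hs : s ∈ Icc (-3 / 10 : ℝ) (-1 / 4)) {U : ℝ} (hU : U ∈ Icc (8 : ℝ) (81 / 10))
    {κ : Type*} [Fintype κ] {w : κ → Site 3} (hw : ∀ b, w b 0 ≠ 0) {tz : κ → ℝ} {R' : ℝ} (hR' : 1 ≤ R')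
    (hwR' : ∀ b, w b ∈ thicken ({0} : Finset (Site 3)) R') (hk : 4 / Real.pi * ∑ b, |tz b| ≤ 1 / 30)
    {ω₁ ω₂ : InfVolFermionState 3} (h₁ : ω₁.IsTranslationInvariant) (h₂ : ω₂.IsTranslationInvariant)
    (hρ₁ : 0 < ω₁.density) (hρ₁' : ω₁.density ≤ 1 / 5) (hρ₂ : 1 ≤ ω₂.density) (hρ₂' : ω₂.density < 2)
    {lam : ℝ} (hl0 : 0 < lam) (hl1 : lam < 1) :
    (layeredHubbardTTPrime 1 s U w tz).tiGroundEnergyDensityAt R' (mix lam hl0.le hl1.le ω₁ ω₂).density <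
      (mix lam hl0.le hl1.le ω₁ ω₂).meanEnergy (layeredHubbardTTPrime 1 s U w tz) R' := by
  refine psL_not_layeredGroundState_mix_above_column 1 hw tz hR' hwR' (s₁ := -3 / 10) (s₂ := -1 / 4) (U₂ := 8) (U₃ := 81 / 10)
    (n₁ := 1 / 5) (n₂ := 1) (a := 5 / 32) (b := 27 / 32) (k := 1 / 30)
    (by norm_num) (by norm_num) (by norm_num) (by norm_num) (by norm_num) (by norm_num) (by norm_num) (by norm_num)
    (lsco78_capPlane_on_cell_of hVB (by norm_num) (by norm_num) (by norm_num))
    (fun s hs => lsco_n1_law8_of hK8 h472 h428 s ⟨hs.1.trans' (by norm_num), hs.2.trans (by norm_num)⟩)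
    (fun s hs U hU => lsco_dilute14_floor_left (n₁ := 1 / 5) (by norm_num) (by norm_num) s hs U (by linarith [hU.1]))
    hk ?_ hs hU h₁ h₂ hρ₁ hρ₁' hρ₂ hρ₂' hl0 hl1
  · intro s hs; obtain ⟨h1, h2⟩ := hs; push_cast; norm_num; nlinarith [h1, h2]

/-- **Right `t′`-half, columns `[79/10, 8]`, `n₁ = 1/5`, `T = 0`, layered, cost `≤ 1/30`.** [cite: Israel1979, Thm. I.2.4] [cite: BratteliKishimotoRobinson1978, Thm. 2 (condition 2)] [cite: EmeryKivelsonLin1990, pp. 475–476] -/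
theorem lsco78_psL_1o5_k1o30_right_columns (hVB : cert_obx32x4tpm1o4D1200_openbox_32x4_N112_planes)
    (hK29 : cert_laBoxE_K2diag_GU29o5n1tpm3o10_j295889_up) (hK8 : cert_laBoxE_K2diag_GU8n1tpm3o10_j299783_up)
    (h21 : cert_r21_luc_tl_upper_n1_U6) (h487 : cert_r487_hubSQ_hanK7R6_U10_r5_e4_so4blk)
    (h427 : cert_r427_hubSQ_hanK7_U5_r5_e4_so4blk) (h488 : cert_r488_hubSQ_hanK7R6_U6_r5_e4_so4blk)
    (h472 : cert_r472_pb2_tl_upper_n1_U8) (h428 : cert_r428_hubSQ_hanK7R6_U8_r5_e4_so4blk)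
    {s : ℝ} (hs : s ∈ Icc (-1 / 4 : ℝ) (-1 / 5)) {U : ℝ} (hU : U ∈ Icc (79 / 10 : ℝ) (8))
    {κ : Type*} [Fintype κ] {w : κ → Site 3} (hw : ∀ b, w b 0 ≠ 0) {tz : κ → ℝ} {R' : ℝ} (hR' : 1 ≤ R')
    (hwR' : ∀ b, w b ∈ thicken ({0} : Finset (Site 3)) R') (hk : 4 / Real.pi * ∑ b, |tz b| ≤ 1 / 30)
    {ω₁ ω₂ : InfVolFermionState 3} (h₁ : ω₁.IsTranslationInvariant) (h₂ : ω₂.IsTranslationInvariant)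
    (hρ₁ : 0 < ω₁.density) (hρ₁' : ω₁.density ≤ 1 / 5) (hρ₂ : 1 ≤ ω₂.density) (hρ₂' : ω₂.density < 2)
    {lam : ℝ} (hl0 : 0 < lam) (hl1 : lam < 1) :
    (layeredHubbardTTPrime 1 s U w tz).tiGroundEnergyDensityAt R' (mix lam hl0.le hl1.le ω₁ ω₂).density <
      (mix lam hl0.le hl1.le ω₁ ω₂).meanEnergy (layeredHubbardTTPrime 1 s U w tz) R' := by
  refine psL_not_layeredGroundState_mix_on_cell_of_columns 1 hw tz hR' hwR' (s₁ := -1 / 4) (s₂ := -1 / 5) (U₁ := 79 / 10) (U₂ := 8)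
    (n₁ := 1 / 5) (n₂ := 1) (a := 5 / 32) (b := 27 / 32) (k := 1 / 30)
    (by norm_num) (by norm_num) (by norm_num) (by norm_num) (by norm_num) (by norm_num) (by norm_num) (by norm_num)
    (lsco78_capPlane_on_cell_of hVB (by norm_num) (by norm_num) (by norm_num))
    (fun s hs => lsco_n1_lawAt_of hK29 hK8 h21 h487 h427 h488 h472 h428 (U₀ := 79 / 10) (by norm_num) s
      ⟨hs.1.trans' (by norm_num), hs.2.trans (by norm_num)⟩)
    (fun s hs => lsco_n1_law8_of hK8 h472 h428 s ⟨hs.1.trans' (by norm_num), hs.2.trans (by norm_num)⟩)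
    (fun s hs U hU => lsco_dilute14_floor_right (n₁ := 1 / 5) (by norm_num) (by norm_num) s hs U (by linarith [hU.1]))
    hk ?_ ?_ hs hU h₁ h₂ hρ₁ hρ₁' hρ₂ hρ₂' hl0 hl1
  · intro s hs; obtain ⟨h1, h2⟩ := hs; push_cast; norm_num; nlinarith [h1, h2]
  · intro s hs; obtain ⟨h1, h2⟩ := hs; push_cast; norm_num; nlinarith [h1, h2]

/-- **Right `t′`-half, `U ∈ [8, 81/10]`, `n₁ = 1/5`, `T = 0`, layered, cost `≤ 1/30`.** [cite: Israel1979, Thm. I.2.4] [cite: BratteliKishimotoRobinson1978, Thm. 2 (condition 2)] -/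
theorem lsco78_psL_1o5_k1o30_right_above (hVB : cert_obx32x4tpm1o4D1200_openbox_32x4_N112_planes)
    (hK8 : cert_laBoxE_K2diag_GU8n1tpm3o10_j299783_up)
    (h472 : cert_r472_pb2_tl_upper_n1_U8) (h428 : cert_r428_hubSQ_hanK7R6_U8_r5_e4_so4blk)
    {s : ℝ} (hs : s ∈ Icc (-1 / 4 : ℝ) (-1 / 5)) {U : ℝ} (hU : U ∈ Icc (8 : ℝ) (81 / 10))
    {κ : Type*} [Fintype κ] {w : κ → Site 3} (hw : ∀ b, w b 0 ≠ 0) {tz : κ → ℝ} {R' : ℝ} (hR' : 1 ≤ R')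
    (hwR' : ∀ b, w b ∈ thicken ({0} : Finset (Site 3)) R') (hk : 4 / Real.pi * ∑ b, |tz b| ≤ 1 / 30)
    {ω₁ ω₂ : InfVolFermionState 3} (h₁ : ω₁.IsTranslationInvariant) (h₂ : ω₂.IsTranslationInvariant)
    (hρ₁ : 0 < ω₁.density) (hρ₁' : ω₁.density ≤ 1 / 5) (hρ₂ : 1 ≤ ω₂.density) (hρ₂' : ω₂.density < 2)
    {lam : ℝ} (hl0 : 0 < lam) (hl1 : lam < 1) :
    (layeredHubbardTTPrime 1 s U w tz).tiGroundEnergyDensityAt R' (mix lam hl0.le hl1.le ω₁ ω₂).density <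
      (mix lam hl0.le hl1.le ω₁ ω₂).meanEnergy (layeredHubbardTTPrime 1 s U w tz) R' := by
  refine psL_not_layeredGroundState_mix_above_column 1 hw tz hR' hwR' (s₁ := -1 / 4) (s₂ := -1 / 5) (U₂ := 8) (U₃ := 81 / 10)
    (n₁ := 1 / 5) (n₂ := 1) (a := 5 / 32) (b := 27 / 32) (k := 1 / 30)
    (by norm_num) (by norm_num) (by norm_num) (by norm_num) (by norm_num) (by norm_num) (by norm_num) (by norm_num)
    (lsco78_capPlane_on_cell_of hVB (by norm_num) (by norm_num) (by norm_num))
    (fun s hs => lsco_n1_law8_of hK8 h472 h428 s ⟨hs.1.trans' (by norm_num), hs.2.trans (by norm_num)⟩)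
    (fun s hs U hU => lsco_dilute14_floor_right (n₁ := 1 / 5) (by norm_num) (by norm_num) s hs U (by linarith [hU.1]))
    hk ?_ hs hU h₁ h₂ hρ₁ hρ₁' hρ₂ hρ₂' hl0 hl1
  · intro s hs; obtain ⟨h1, h2⟩ := hs; push_cast; norm_num; nlinarith [h1, h2]

/-- **THE `T = 0` INTERLAYER SENTENCE: `(≤ 1/5 | ≥ 1)` coexistence EXCLUDED among ground states of the layered crystal `layeredHubbardTTPrime 1 s U w tz` on `t′ ∈ [−3/10, −1/5] × U ∈ [79/10, 81/10]` for EVERY stacking with `(4/π)Σ_b|t_{z,b}| ≤ 1/30`**: for every `(s, U)` of the cell, every such stacking, every translation-invariant `ω₁, ω₂` on `ℤ³` with `0 < ρ(ω₁) ≤ 1/5`, `1 ≤ ρ(ω₂) < 2` and every `0 < λ < 1`, the mixture is NOT a ground state of the layered crystal at its filling. [cite: Israel1979, Thm. I.2.4] [cite: BratteliKishimotoRobinson1978, Thm. 2 (condition 2)] [cite: EmeryKivelsonLin1990, pp. 475–476] -/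
theorem lsco78_not_layeredGroundState_mix_le_1o5_ge_one_of_cost_le_1o30 (hVB : cert_obx32x4tpm1o4D1200_openbox_32x4_N112_planes)
    (hK29 : cert_laBoxE_K2diag_GU29o5n1tpm3o10_j295889_up) (hK8 : cert_laBoxE_K2diag_GU8n1tpm3o10_j299783_up)
    (h21 : cert_r21_luc_tl_upper_n1_U6) (h487 : cert_r487_hubSQ_hanK7R6_U10_r5_e4_so4blk)
    (h427 : cert_r427_hubSQ_hanK7_U5_r5_e4_so4blk) (h488 : cert_r488_hubSQ_hanK7R6_U6_r5_e4_so4blk)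
    (h472 : cert_r472_pb2_tl_upper_n1_U8) (h428 : cert_r428_hubSQ_hanK7R6_U8_r5_e4_so4blk)
    {s : ℝ} (hs : s ∈ Icc (-3 / 10 : ℝ) (-1 / 5)) {U : ℝ} (hU : U ∈ Icc (79 / 10 : ℝ) (81 / 10))
    {κ : Type*} [Fintype κ] {w : κ → Site 3} (hw : ∀ b, w b 0 ≠ 0) {tz : κ → ℝ} {R' : ℝ} (hR' : 1 ≤ R')
    (hwR' : ∀ b, w b ∈ thicken ({0} : Finset (Site 3)) R') (hk : 4 / Real.pi * ∑ b, |tz b| ≤ 1 / 30)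
    {ω₁ ω₂ : InfVolFermionState 3} (h₁ : ω₁.IsTranslationInvariant) (h₂ : ω₂.IsTranslationInvariant)
    (hρ₁ : 0 < ω₁.density) (hρ₁' : ω₁.density ≤ 1 / 5) (hρ₂ : 1 ≤ ω₂.density) (hρ₂' : ω₂.density < 2)
    {lam : ℝ} (hl0 : 0 < lam) (hl1 : lam < 1) :
    (layeredHubbardTTPrime 1 s U w tz).tiGroundEnergyDensityAt R' (mix lam hl0.le hl1.le ω₁ ω₂).density <
      (mix lam hl0.le hl1.le ω₁ ω₂).meanEnergy (layeredHubbardTTPrime 1 s U w tz) R' := by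
  rcases le_total s (-1 / 4) with hsl | hsr
  · rcases le_total U 8 with hUl | hUr
    · exact lsco78_psL_1o5_k1o30_left_columns hVB hK29 hK8 h21 h487 h427 h488 h472 h428 ⟨hs.1, hsl⟩ ⟨hU.1, hUl⟩ hw hR' hwR' hk h₁ h₂ hρ₁ hρ₁' hρ₂ hρ₂' hl0 hl1
    · exact lsco78_psL_1o5_k1o30_left_above hVB hK8 h472 h428 ⟨hs.1, hsl⟩ ⟨hUr, hU.2⟩ hw hR' hwR' hk h₁ h₂ hρ₁ hρ₁' hρ₂ hρ₂' hl0 hl1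
  · rcases le_total U 8 with hUl | hUr
    · exact lsco78_psL_1o5_k1o30_right_columns hVB hK29 hK8 h21 h487 h427 h488 h472 h428 ⟨hsr, hs.2⟩ ⟨hU.1, hUl⟩ hw hR' hwR' hk h₁ h₂ hρ₁ hρ₁' hρ₂ hρ₂' hl0 hl1
    · exact lsco78_psL_1o5_k1o30_right_above hVB hK8 h472 h428 ⟨hsr, hs.2⟩ ⟨hUr, hU.2⟩ hw hR' hwR' hk h₁ h₂ hρ₁ hρ₁' hρ₂ hρ₂' hl0 hl1

/-! ## §2 `T > 0`: `(≤ 1/5 | ≥ 1)` coexistence EXCLUDED among canonical equilibrium states of the LAYERED crystal on the same cell, every `β ≥ 30`, every stacking with `(4/π)Σ|tz| ≤ 1 / 100` -/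

/-- **Left `t′`-half, columns `[79/10, 8]`, `n₁ = 1/5`, `β ≥ 30`, layered, cost `≤ 1 / 100`** (hot-anchored). [cite: Israel1979, Thm. I.2.4] [cite: PoulinHastings2011, eqs. (3)–(8)] [cite: BratteliKishimotoRobinson1978, Thm. 2 (condition 2)] -/
theorem lsco78_psLT_1o5_beta30_k1o100_left_columns (hVB : cert_obx32x4tpm1o4D1200_openbox_32x4_N112_planes)
    (hK29 : cert_laBoxE_K2diag_GU29o5n1tpm3o10_j295889_up) (hK8 : cert_laBoxE_K2diag_GU8n1tpm3o10_j299783_up)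
    (h21 : cert_r21_luc_tl_upper_n1_U6) (h487 : cert_r487_hubSQ_hanK7R6_U10_r5_e4_so4blk)
    (h427 : cert_r427_hubSQ_hanK7_U5_r5_e4_so4blk) (h488 : cert_r488_hubSQ_hanK7R6_U6_r5_e4_so4blk)
    (h472 : cert_r472_pb2_tl_upper_n1_U8) (h428 : cert_r428_hubSQ_hanK7R6_U8_r5_e4_so4blk)
    (hLL : cert_feC1tt_3x2_tpm5o16_U15o2_b3o4_j290715) (hRL : cert_feC1tt_3x2_tpm3o16_U15o2_b3o4_j290716)
    {s : ℝ} (hs : s ∈ Icc (-3 / 10 : ℝ) (-1 / 4)) {U : ℝ} (hU : U ∈ Icc (79 / 10 : ℝ) (8))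
    {β : ℝ} (hβ : (30 : ℝ) ≤ β)
    {κ : Type*} [Fintype κ] {w : κ → Site 3} (hw : ∀ b, w b 0 ≠ 0) {tz : κ → ℝ} {R' : ℝ} (hR' : 1 ≤ R')
    (hwR' : ∀ b, w b ∈ thicken ({0} : Finset (Site 3)) R') (hk : 4 / Real.pi * ∑ b, |tz b| ≤ 1 / 100)
    {ω₁ ω₂ : InfVolFermionState 3} (h₁ : ω₁.IsTranslationInvariant) (h₂ : ω₂.IsTranslationInvariant)
    (hρ₁ : 0 < ω₁.density) (hρ₁' : ω₁.density ≤ 1 / 5) (hρ₂ : 1 ≤ ω₂.density) (hρ₂' : ω₂.density < 2)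
    {lam : ℝ} (hl0 : 0 < lam) (hl1 : lam < 1) :
    (mix lam hl0.le hl1.le ω₁ ω₂).entropyDensitySup -
        β * (mix lam hl0.le hl1.le ω₁ ω₂).meanEnergy (layeredHubbardTTPrime 1 s U w tz) R' <
      (layeredHubbardTTPrime 1 s U w tz).varPressureAt β R' (mix lam hl0.le hl1.le ω₁ ω₂).density := by
  refine psLT_not_layeredEquilibrium_mix_on_cell_of_columns_hotAnchor 1 hw tz hR' hwR' (s₁ := -3 / 10) (s₂ := -1 / 4) (U₁ := 79 / 10) (U₂ := 8)
    (n₁ := 1 / 5) (n₂ := 1) (a := 5 / 32) (b := 27 / 32) (β₀ := 30) (βh₁ := 0) (βh₂ := 3 / 4)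
    (π₁ := 0.666) (π₂ := 5523207596574253 / 4503599627370496) (k := 1 / 100)
    (by norm_num) (by norm_num) (by norm_num) (by norm_num) (by norm_num) (by norm_num) (by norm_num) (by norm_num)
    (by norm_num) (by norm_num) (by norm_num) (by norm_num) hβ (by norm_num)
    (lsco78_capPlane_on_cell_of hVB (by norm_num) (by norm_num) (by norm_num))
    (fun s hs => lsco_n1_lawAt_of hK29 hK8 h21 h487 h427 h488 h472 h428 (U₀ := 79 / 10) (by norm_num) s
      ⟨hs.1.trans' (by norm_num), hs.2.trans (by norm_num)⟩)
    (fun s hs => lsco_n1_law8_of hK8 h472 h428 s ⟨hs.1.trans' (by norm_num), hs.2.trans (by norm_num)⟩)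
    (fun s hs U hU => lsco_dilute14_floor_left (n₁ := 1 / 5) (by norm_num) (by norm_num) s hs U (by linarith [hU.1]))
    (lsco_diluteCap_1o5 (by norm_num))
    (lsco_hotCap_n1_b3o4_on_cell hLL hRL (by norm_num) (by norm_num) (by norm_num))
    hk ?_ ?_ ?_ ?_ hs hU h₁ h₂ hρ₁ hρ₁' hρ₂ hρ₂' hl0 hl1
  · intro s hs; obtain ⟨h1, h2⟩ := hs; push_cast; norm_num; nlinarith [h1, h2]
  · intro s hs; obtain ⟨h1, h2⟩ := hs; push_cast; norm_num; nlinarith [h1, h2]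
  · intro s hs; obtain ⟨h1, h2⟩ := hs; push_cast; norm_num; nlinarith [h1, h2]
  · intro s hs; obtain ⟨h1, h2⟩ := hs; push_cast; norm_num; nlinarith [h1, h2]

/-- **Left `t′`-half, `U ∈ [8, 81/10]`, `n₁ = 1/5`, `β ≥ 30`, layered, cost `≤ 1 / 100`** (hot-anchored). [cite: Israel1979, Thm. I.2.4] [cite: BratteliKishimotoRobinson1978, Thm. 2 (condition 2)] [cite: PoulinHastings2011, eqs. (3)–(8)] -/
theorem lsco78_psLT_1o5_beta30_k1o100_left_above (hVB : cert_obx32x4tpm1o4D1200_openbox_32x4_N112_planes)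
    (hK8 : cert_laBoxE_K2diag_GU8n1tpm3o10_j299783_up)
    (h472 : cert_r472_pb2_tl_upper_n1_U8) (h428 : cert_r428_hubSQ_hanK7R6_U8_r5_e4_so4blk)
    (hLL : cert_feC1tt_3x2_tpm5o16_U15o2_b3o4_j290715) (hRL : cert_feC1tt_3x2_tpm3o16_U15o2_b3o4_j290716)
    {s : ℝ} (hs : s ∈ Icc (-3 / 10 : ℝ) (-1 / 4)) {U : ℝ} (hU : U ∈ Icc (8 : ℝ) (81 / 10))
    {β : ℝ} (hβ : (30 : ℝ) ≤ β)
    {κ : Type*} [Fintype κ] {w : κ → Site 3} (hw : ∀ b, w b 0 ≠ 0) {tz : κ → ℝ} {R' : ℝ} (hR' : 1 ≤ R')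
    (hwR' : ∀ b, w b ∈ thicken ({0} : Finset (Site 3)) R') (hk : 4 / Real.pi * ∑ b, |tz b| ≤ 1 / 100)
    {ω₁ ω₂ : InfVolFermionState 3} (h₁ : ω₁.IsTranslationInvariant) (h₂ : ω₂.IsTranslationInvariant)
    (hρ₁ : 0 < ω₁.density) (hρ₁' : ω₁.density ≤ 1 / 5) (hρ₂ : 1 ≤ ω₂.density) (hρ₂' : ω₂.density < 2)
    {lam : ℝ} (hl0 : 0 < lam) (hl1 : lam < 1) :
    (mix lam hl0.le hl1.le ω₁ ω₂).entropyDensitySup -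
        β * (mix lam hl0.le hl1.le ω₁ ω₂).meanEnergy (layeredHubbardTTPrime 1 s U w tz) R' <
      (layeredHubbardTTPrime 1 s U w tz).varPressureAt β R' (mix lam hl0.le hl1.le ω₁ ω₂).density := by
  refine psLT_not_layeredEquilibrium_mix_above_column_hotAnchor 1 hw tz hR' hwR' (s₁ := -3 / 10) (s₂ := -1 / 4) (U₂ := 8) (U₃ := 81 / 10)
    (n₁ := 1 / 5) (n₂ := 1) (a := 5 / 32) (b := 27 / 32) (β₀ := 30) (βh₁ := 0) (βh₂ := 3 / 4)
    (π₁ := 0.666) (π₂ := 5523207596574253 / 4503599627370496) (k := 1 / 100)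
    (by norm_num) (by norm_num) (by norm_num) (by norm_num) (by norm_num) (by norm_num) (by norm_num) (by norm_num)
    (by norm_num) (by norm_num) (by norm_num) (by norm_num) hβ (by norm_num)
    (lsco78_capPlane_on_cell_of hVB (by norm_num) (by norm_num) (by norm_num))
    (fun s hs => lsco_n1_law8_of hK8 h472 h428 s ⟨hs.1.trans' (by norm_num), hs.2.trans (by norm_num)⟩)
    (fun s hs U hU => lsco_dilute14_floor_left (n₁ := 1 / 5) (by norm_num) (by norm_num) s hs U (by linarith [hU.1]))
    (lsco_diluteCap_1o5 (by norm_num))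
    (lsco_hotCap_n1_b3o4_on_cell hLL hRL (by norm_num) (by norm_num) (by norm_num))
    hk ?_ ?_ hs hU h₁ h₂ hρ₁ hρ₁' hρ₂ hρ₂' hl0 hl1
  · intro s hs; obtain ⟨h1, h2⟩ := hs; push_cast; norm_num; nlinarith [h1, h2]
  · intro s hs; obtain ⟨h1, h2⟩ := hs; push_cast; norm_num; nlinarith [h1, h2]

/-- **Right `t′`-half, columns `[79/10, 8]`, `n₁ = 1/5`, `β ≥ 30`, layered, cost `≤ 1 / 100`** (hot-anchored). [cite: Israel1979, Thm. I.2.4] [cite: PoulinHastings2011, eqs. (3)–(8)] [cite: BratteliKishimotoRobinson1978, Thm. 2 (condition 2)] -/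
theorem lsco78_psLT_1o5_beta30_k1o100_right_columns (hVB : cert_obx32x4tpm1o4D1200_openbox_32x4_N112_planes)
    (hK29 : cert_laBoxE_K2diag_GU29o5n1tpm3o10_j295889_up) (hK8 : cert_laBoxE_K2diag_GU8n1tpm3o10_j299783_up)
    (h21 : cert_r21_luc_tl_upper_n1_U6) (h487 : cert_r487_hubSQ_hanK7R6_U10_r5_e4_so4blk)
    (h427 : cert_r427_hubSQ_hanK7_U5_r5_e4_so4blk) (h488 : cert_r488_hubSQ_hanK7R6_U6_r5_e4_so4blk)
    (h472 : cert_r472_pb2_tl_upper_n1_U8) (h428 : cert_r428_hubSQ_hanK7R6_U8_r5_e4_so4blk)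
    (hLL : cert_feC1tt_3x2_tpm5o16_U15o2_b3o4_j290715) (hRL : cert_feC1tt_3x2_tpm3o16_U15o2_b3o4_j290716)
    {s : ℝ} (hs : s ∈ Icc (-1 / 4 : ℝ) (-1 / 5)) {U : ℝ} (hU : U ∈ Icc (79 / 10 : ℝ) (8))
    {β : ℝ} (hβ : (30 : ℝ) ≤ β)
    {κ : Type*} [Fintype κ] {w : κ → Site 3} (hw : ∀ b, w b 0 ≠ 0) {tz : κ → ℝ} {R' : ℝ} (hR' : 1 ≤ R')
    (hwR' : ∀ b, w b ∈ thicken ({0} : Finset (Site 3)) R') (hk : 4 / Real.pi * ∑ b, |tz b| ≤ 1 / 100)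
    {ω₁ ω₂ : InfVolFermionState 3} (h₁ : ω₁.IsTranslationInvariant) (h₂ : ω₂.IsTranslationInvariant)
    (hρ₁ : 0 < ω₁.density) (hρ₁' : ω₁.density ≤ 1 / 5) (hρ₂ : 1 ≤ ω₂.density) (hρ₂' : ω₂.density < 2)
    {lam : ℝ} (hl0 : 0 < lam) (hl1 : lam < 1) :
    (mix lam hl0.le hl1.le ω₁ ω₂).entropyDensitySup -
        β * (mix lam hl0.le hl1.le ω₁ ω₂).meanEnergy (layeredHubbardTTPrime 1 s U w tz) R' <
      (layeredHubbardTTPrime 1 s U w tz).varPressureAt β R' (mix lam hl0.le hl1.le ω₁ ω₂).density := by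
  refine psLT_not_layeredEquilibrium_mix_on_cell_of_columns_hotAnchor 1 hw tz hR' hwR' (s₁ := -1 / 4) (s₂ := -1 / 5) (U₁ := 79 / 10) (U₂ := 8)
    (n₁ := 1 / 5) (n₂ := 1) (a := 5 / 32) (b := 27 / 32) (β₀ := 30) (βh₁ := 0) (βh₂ := 3 / 4)
    (π₁ := 0.666) (π₂ := 5523207596574253 / 4503599627370496) (k := 1 / 100)
    (by norm_num) (by norm_num) (by norm_num) (by norm_num) (by norm_num) (by norm_num) (by norm_num) (by norm_num)
    (by norm_num) (by norm_num) (by norm_num) (by norm_num) hβ (by norm_num)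
    (lsco78_capPlane_on_cell_of hVB (by norm_num) (by norm_num) (by norm_num))
    (fun s hs => lsco_n1_lawAt_of hK29 hK8 h21 h487 h427 h488 h472 h428 (U₀ := 79 / 10) (by norm_num) s
      ⟨hs.1.trans' (by norm_num), hs.2.trans (by norm_num)⟩)
    (fun s hs => lsco_n1_law8_of hK8 h472 h428 s ⟨hs.1.trans' (by norm_num), hs.2.trans (by norm_num)⟩)
    (fun s hs U hU => lsco_dilute14_floor_right (n₁ := 1 / 5) (by norm_num) (by norm_num) s hs U (by linarith [hU.1]))
    (lsco_diluteCap_1o5 (by norm_num))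
    (lsco_hotCap_n1_b3o4_on_cell hLL hRL (by norm_num) (by norm_num) (by norm_num))
    hk ?_ ?_ ?_ ?_ hs hU h₁ h₂ hρ₁ hρ₁' hρ₂ hρ₂' hl0 hl1
  · intro s hs; obtain ⟨h1, h2⟩ := hs; push_cast; norm_num; nlinarith [h1, h2]
  · intro s hs; obtain ⟨h1, h2⟩ := hs; push_cast; norm_num; nlinarith [h1, h2]
  · intro s hs; obtain ⟨h1, h2⟩ := hs; push_cast; norm_num; nlinarith [h1, h2]
  · intro s hs; obtain ⟨h1, h2⟩ := hs; push_cast; norm_num; nlinarith [h1, h2]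

/-- **Right `t′`-half, `U ∈ [8, 81/10]`, `n₁ = 1/5`, `β ≥ 30`, layered, cost `≤ 1 / 100`** (hot-anchored). [cite: Israel1979, Thm. I.2.4] [cite: BratteliKishimotoRobinson1978, Thm. 2 (condition 2)] [cite: PoulinHastings2011, eqs. (3)–(8)] -/
theorem lsco78_psLT_1o5_beta30_k1o100_right_above (hVB : cert_obx32x4tpm1o4D1200_openbox_32x4_N112_planes)
    (hK8 : cert_laBoxE_K2diag_GU8n1tpm3o10_j299783_up)
    (h472 : cert_r472_pb2_tl_upper_n1_U8) (h428 : cert_r428_hubSQ_hanK7R6_U8_r5_e4_so4blk)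
    (hLL : cert_feC1tt_3x2_tpm5o16_U15o2_b3o4_j290715) (hRL : cert_feC1tt_3x2_tpm3o16_U15o2_b3o4_j290716)
    {s : ℝ} (hs : s ∈ Icc (-1 / 4 : ℝ) (-1 / 5)) {U : ℝ} (hU : U ∈ Icc (8 : ℝ) (81 / 10))
    {β : ℝ} (hβ : (30 : ℝ) ≤ β)
    {κ : Type*} [Fintype κ] {w : κ → Site 3} (hw : ∀ b, w b 0 ≠ 0) {tz : κ → ℝ} {R' : ℝ} (hR' : 1 ≤ R')
    (hwR' : ∀ b, w b ∈ thicken ({0} : Finset (Site 3)) R') (hk : 4 / Real.pi * ∑ b, |tz b| ≤ 1 / 100)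
    {ω₁ ω₂ : InfVolFermionState 3} (h₁ : ω₁.IsTranslationInvariant) (h₂ : ω₂.IsTranslationInvariant)
    (hρ₁ : 0 < ω₁.density) (hρ₁' : ω₁.density ≤ 1 / 5) (hρ₂ : 1 ≤ ω₂.density) (hρ₂' : ω₂.density < 2)
    {lam : ℝ} (hl0 : 0 < lam) (hl1 : lam < 1) :
    (mix lam hl0.le hl1.le ω₁ ω₂).entropyDensitySup -
        β * (mix lam hl0.le hl1.le ω₁ ω₂).meanEnergy (layeredHubbardTTPrime 1 s U w tz) R' <
      (layeredHubbardTTPrime 1 s U w tz).varPressureAt β R' (mix lam hl0.le hl1.le ω₁ ω₂).density := by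
  refine psLT_not_layeredEquilibrium_mix_above_column_hotAnchor 1 hw tz hR' hwR' (s₁ := -1 / 4) (s₂ := -1 / 5) (U₂ := 8) (U₃ := 81 / 10)
    (n₁ := 1 / 5) (n₂ := 1) (a := 5 / 32) (b := 27 / 32) (β₀ := 30) (βh₁ := 0) (βh₂ := 3 / 4)
    (π₁ := 0.666) (π₂ := 5523207596574253 / 4503599627370496) (k := 1 / 100)
    (by norm_num) (by norm_num) (by norm_num) (by norm_num) (by norm_num) (by norm_num) (by norm_num) (by norm_num)
    (by norm_num) (by norm_num) (by norm_num) (by norm_num) hβ (by norm_num)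
    (lsco78_capPlane_on_cell_of hVB (by norm_num) (by norm_num) (by norm_num))
    (fun s hs => lsco_n1_law8_of hK8 h472 h428 s ⟨hs.1.trans' (by norm_num), hs.2.trans (by norm_num)⟩)
    (fun s hs U hU => lsco_dilute14_floor_right (n₁ := 1 / 5) (by norm_num) (by norm_num) s hs U (by linarith [hU.1]))
    (lsco_diluteCap_1o5 (by norm_num))
    (lsco_hotCap_n1_b3o4_on_cell hLL hRL (by norm_num) (by norm_num) (by norm_num))
    hk ?_ ?_ hs hU h₁ h₂ hρ₁ hρ₁' hρ₂ hρ₂' hl0 hl1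
  · intro s hs; obtain ⟨h1, h2⟩ := hs; push_cast; norm_num; nlinarith [h1, h2]
  · intro s hs; obtain ⟨h1, h2⟩ := hs; push_cast; norm_num; nlinarith [h1, h2]

/-- **THE `T > 0` INTERLAYER SENTENCE: `(≤ 1/5 | ≥ 1)` coexistence EXCLUDED among canonical equilibrium states of the layered crystal on `t′ ∈ [−3/10, −1/5] × U ∈ [79/10, 81/10]` for EVERY `β ≥ 30` and EVERY stacking with `(4/π)Σ_b|t_{z,b}| ≤ 1 / 100`** (`T ≲ 132–155 K` at `t ∈ [0.34, 0.40]` eV [float]; decoupled layers: `β ≥ 21`): for every `(s, U)` of the cell, every such `β` and stacking, every translation-invariant `ω₁, ω₂` on `ℤ³` with `0 < ρ(ω₁) ≤ 1/5`, `1 ≤ ρ(ω₂) < 2` and every `0 < λ < 1`, the mixture is NOT a canonical equilibrium state of the layered crystal at `β` (`s̄ − β e_{Φ₃} < P₃(β; ρ)`). [cite: Israel1979, Thm. I.2.4] [cite: EmeryKivelsonLin1990, pp. 475–476] [cite: PoulinHastings2011, eqs. (3)–(8)] -/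
theorem lsco78_not_layeredEquilibrium_mix_le_1o5_ge_one_beta30_of_cost_le_1o100 (hVB : cert_obx32x4tpm1o4D1200_openbox_32x4_N112_planes)
    (hK29 : cert_laBoxE_K2diag_GU29o5n1tpm3o10_j295889_up) (hK8 : cert_laBoxE_K2diag_GU8n1tpm3o10_j299783_up)
    (h21 : cert_r21_luc_tl_upper_n1_U6) (h487 : cert_r487_hubSQ_hanK7R6_U10_r5_e4_so4blk)
    (h427 : cert_r427_hubSQ_hanK7_U5_r5_e4_so4blk) (h488 : cert_r488_hubSQ_hanK7R6_U6_r5_e4_so4blk)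
    (h472 : cert_r472_pb2_tl_upper_n1_U8) (h428 : cert_r428_hubSQ_hanK7R6_U8_r5_e4_so4blk)
    (hLL : cert_feC1tt_3x2_tpm5o16_U15o2_b3o4_j290715) (hRL : cert_feC1tt_3x2_tpm3o16_U15o2_b3o4_j290716)
    {s : ℝ} (hs : s ∈ Icc (-3 / 10 : ℝ) (-1 / 5)) {U : ℝ} (hU : U ∈ Icc (79 / 10 : ℝ) (81 / 10))
    {β : ℝ} (hβ : (30 : ℝ) ≤ β)
    {κ : Type*} [Fintype κ] {w : κ → Site 3} (hw : ∀ b, w b 0 ≠ 0) {tz : κ → ℝ} {R' : ℝ} (hR' : 1 ≤ R')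
    (hwR' : ∀ b, w b ∈ thicken ({0} : Finset (Site 3)) R') (hk : 4 / Real.pi * ∑ b, |tz b| ≤ 1 / 100)
    {ω₁ ω₂ : InfVolFermionState 3} (h₁ : ω₁.IsTranslationInvariant) (h₂ : ω₂.IsTranslationInvariant)
    (hρ₁ : 0 < ω₁.density) (hρ₁' : ω₁.density ≤ 1 / 5) (hρ₂ : 1 ≤ ω₂.density) (hρ₂' : ω₂.density < 2)
    {lam : ℝ} (hl0 : 0 < lam) (hl1 : lam < 1) :
    (mix lam hl0.le hl1.le ω₁ ω₂).entropyDensitySup -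
        β * (mix lam hl0.le hl1.le ω₁ ω₂).meanEnergy (layeredHubbardTTPrime 1 s U w tz) R' <
      (layeredHubbardTTPrime 1 s U w tz).varPressureAt β R' (mix lam hl0.le hl1.le ω₁ ω₂).density := by
  rcases le_total s (-1 / 4) with hsl | hsr
  · rcases le_total U 8 with hUl | hUr
    · exact lsco78_psLT_1o5_beta30_k1o100_left_columns hVB hK29 hK8 h21 h487 h427 h488 h472 h428 hLL hRL ⟨hs.1, hsl⟩ ⟨hU.1, hUl⟩ hβ hw hR' hwR' hk h₁ h₂ hρ₁ hρ₁' hρ₂ hρ₂' hl0 hl1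
    · exact lsco78_psLT_1o5_beta30_k1o100_left_above hVB hK8 h472 h428 hLL hRL ⟨hs.1, hsl⟩ ⟨hUr, hU.2⟩ hβ hw hR' hwR' hk h₁ h₂ hρ₁ hρ₁' hρ₂ hρ₂' hl0 hl1
  · rcases le_total U 8 with hUl | hUr
    · exact lsco78_psLT_1o5_beta30_k1o100_right_columns hVB hK29 hK8 h21 h487 h427 h488 h472 h428 hLL hRL ⟨hsr, hs.2⟩ ⟨hU.1, hUl⟩ hβ hw hR' hwR' hk h₁ h₂ hρ₁ hρ₁' hρ₂ hρ₂' hl0 hl1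
    · exact lsco78_psLT_1o5_beta30_k1o100_right_above hVB hK8 h472 h428 hLL hRL ⟨hsr, hs.2⟩ ⟨hUr, hU.2⟩ hβ hw hR' hwR' hk h₁ h₂ hρ₁ hρ₁' hρ₂ hρ₂' hl0 hl1

end Summit.Ventures.CertifiedManyBodySolver.Downfold
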